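import Mathlib
import HarnessLib
import Summits.Ventures.LatticeQCDFlow.Exactness.SphereActionThirdMomentReduction

/-!
# The third cumulant of the lattice CP(N−1)/O(N) action under the uniform measure and Lüscher's NNLO constant in closed form: `∫(S − S₀)³ dπ̄ = −(8κ³/d³)·Σ_{k,n,m} tr(U_mk U_kn U_nm)` and `ċ₂ = (4κ³/d³)·Σ_{k,n,m} tr(U_mk U_kn U_nm)` — a sum over ORIENTED TRIANGLES of the coupling graph, zero on every triangle-free graph

HONEST FRAMING: exact (Metropolis-corrected) sampling algorithms for lattice gauge theory;
figures of merit are autocorrelation/cost numbers at stated couplings and volumes; no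
continuum-physics claim.

Venture `LatticeQCDFlow` (cell pub-lqcd), topic `Exactness`; FANOUT row 7 (`s0-cpn-null`).  NEW WORK
of the cell over the tree's `Exactness/SphereActionThirdMomentReduction.lean` (this leg:
`(d−1)·∫(S − S₀)³ = 4κ²·Σ_k ∫(S − S₀)(‖J_k‖² − ⟪J_k, x_k⟫²)`, `∫(S − S₀)⟪J_k, x_k⟫² =
(1/d)·∫(S − S₀)‖J_k‖²`), `Exactness/SphereLatticeThirdMoments.lean` (this leg:
`∫(S − S₀)‖J_k‖² dπ̄ = −(2κ/d²)·Σ_{n,m} Σ_i ⟪U_kn U_nm b_i, U_km b_i⟫`),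
`Exactness/SphereLuscherMomentIdentity.lean` (GEN-12 T3a: `ċ₂ = (m₃ − 3m₁m₂ + 2m₁³)/2` for every
`C²` Lüscher series of a `C¹` action), `Exactness/SphereLuscherConstantsParity.lean` (GEN-12 T4: a
Lüscher series of `S` is one of `S − a`) and `Exactness/SphereLuscherSeriesConstants.lean`
(`∫S dπ̄ = S₀`); nothing is cited as a fact.  Printed counterpart, NAMED ONLY: M. Lüscher, Commun.
Math. Phys. 293 (2010) 899, §4.2 eqs. (4.9)–(4.10) (`Ċ_t = (d/dt) ln⟨e^{−tS}⟩`: the constants are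
the cumulants of the action, `ċ₂ = κ₃(−S)/2`); Engel–Schaefer, Comput. Phys. Commun. 182 (2011)
2107, §2 eqs. (6)–(7), §3 (their construction stops at the NLO term of the flow-action series).

THIS FILE closes GEN-12's typed follow-up (c) "ċ₂ in closed form for the E–S action on a general
coupling graph": the third central moment of `S = −κ Σ_n ⟪x_n, J_n⟫ + S₀` under `π̄ = ⊗σ̄` is a
sum over oriented closed 3-paths `k → n → m → k` of the trace of the transport around them — the
only index pattern of `⟪x, Ux⟫³` in which every site appears exactly twice — and hence so is `ċ₂`.

## Content (`d = dim E ≥ 2`, `Λ` finite, no self-coupling `U_nn = 0`, adjoint pairs `U_mn = U_nmᵀ`;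
`τ(k,n,m) = Σ_i ⟪U_kn U_nm b_i, U_km b_i⟫ = tr(U_mk U_kn U_nm)`, `b` the standard orthonormal basis)

* §3 **`third_moment_esAction_eq`** — THE THIRD CUMULANT OF THE ACTION IN CLOSED FORM:
  `∫ (S − S₀)³ dπ̄ = −(8κ³/d³)·Σ_k Σ_n Σ_m τ(k,n,m)` (assemble §1–§2 of the reduction file with the
  third-order link sum and divide by `d − 1 > 0`); `integral_pow_three_const_sub_esAction`
  (`∫(S₀ − S)³ dπ̄ = (8κ³/d³)·Σ τ`); `sum_triangle_trace_eq_zero_of_triangle_free` and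
  **`third_moment_esAction_eq_zero_of_triangle_free`** — on a TRIANGLE-FREE coupling graph
  (`U_kn ≠ 0 ∧ U_nm ≠ 0 ⇒ U_km = 0`) the third central moment vanishes.
* §4 **`luscher_constant_two_eq_triangles`** — LÜSCHER'S NNLO CONSTANT: for EVERY `C²` Lüscher
  series of the E–S action, `ċ₂ = (4κ³/d³)·Σ_k Σ_n Σ_m τ(k,n,m)` (the series of `S` is a series of
  `S − S₀`, whose first moment vanishes, so T3a's `ċ₂ = (m₃ − 3m₁m₂ + 2m₁³)/2` reads `ċ₂ = m₃/2`);
  **`luscher_constant_two_eq_zero_of_triangle_free`** — `ċ₂ = 0` on every triangle-free coupling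
  graph (bipartite graphs — parity, GEN-12 T4 — have no odd cycles at all; the periodic square
  lattice with `L ≥ 4`, even OR odd, is triangle-free).

NOT CLAIMED: `ċ₃` and higher (fourth-order lattice sums need the fourth site moment
`E[x⊗x⊗x⊗x] = (δδ+δδ+δδ)/(d(d+2))`, not in the tree); the sign or size of `Σ τ` for particular
transporters (for U(1) phases on `ℂ^N` it is `d·Σ cos(flux)` over oriented triangles — not typed
here); that the square lattice with `L ≥ 4` satisfies the triangle-free hypothesis (not
instantiated); anything at flow time `t > 0`; convergence; the rung's numbers.
-/

noncomputable section

namespace Summit.Ventures.LatticeQCDFlow.Exactness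

open Function Set Metric MeasureTheory NormedSpace InnerProductSpace
open scoped RealInnerProductSpace

variable {Λ : Type*} {E : Type*} [NormedAddCommGroup E] [InnerProductSpace ℝ E]
  [FiniteDimensional ℝ E] [MeasurableSpace E] [BorelSpace E] [Fintype Λ] [DecidableEq Λ] [Nontrivial E]
  {U : Λ → Λ → (E →L[ℝ] E)}

/-! ## §3 The third cumulant of the action in closed form -/

section ThirdMoment

/-- **THE THIRD CENTRAL MOMENT OF THE LATTICE CP(N−1)/O(N) ACTION UNDER THE UNIFORM PRODUCT MEASURE**:
`∫ (S − S₀)³ dπ̄ = −(8κ³/d³)·Σ_k Σ_n Σ_m Σ_i ⟪U_kn U_nm b_i, U_km b_i⟫` — minus `8κ³/d³` times the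
sum over oriented closed 3-paths `k → n → m → k` of the trace of the transport around them (every
finite lattice, every family of transporters with `U_nn = 0`, `U_mn = U_nmᵀ`, `d ≥ 2`). -/
theorem third_moment_esAction_eq (h2 : 2 ≤ Module.finrank ℝ E) (hU0 : ∀ n, U n n = 0)
    (hUadj : ∀ m n (v w : E), ⟪U m n v, w⟫ = ⟪v, U n m w⟫) (κ S₀ : ℝ) :
    ∫ ω, (esAction κ S₀ U (fun m => ((ω : Λ → sphere (0 : E) 1) m : E)) - S₀) ^ 3
        ∂Measure.pi (fun _ : Λ => uniformSphere (volume : Measure E)) =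
      -(8 * κ ^ 3) / (Module.finrank ℝ E : ℝ) ^ 3 *
        ∑ k, ∑ n, ∑ m, ∑ i, ⟪U k n (U n m (stdOrthonormalBasis ℝ E i)),
          U k m (stdOrthonormalBasis ℝ E i)⟫ := by
  have hd : (Module.finrank ℝ E : ℝ) ≠ 0 := by
    have : (0 : ℝ) < (Module.finrank ℝ E : ℝ) := by exact_mod_cast Module.finrank_pos
    exact this.ne'
  have hd1 : (Module.finrank ℝ E : ℝ) - 1 ≠ 0 := by
    have : (2 : ℝ) ≤ Module.finrank ℝ E := by exact_mod_cast h2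
    linarith
  have h := third_moment_eq_sum_integral_mul_localField hU0 hUadj κ S₀
  have hS : Continuous fun ω : Λ → sphere (0 : E) 1 =>
      esAction κ S₀ U (fun m => (ω m : E)) - S₀ :=
    ((contDiff_esAction U κ S₀ (m := 0)).continuous.comp continuous_sphereConfig).sub continuous_const
  have hJs : ∀ k, Continuous fun ω : Λ → sphere (0 : E) 1 => localField U k (fun m => (ω m : E)) :=
    fun k => (contDiff_localField U k (m := 0)).continuous.comp continuous_sphereConfig
  have hk : ∀ k, ∫ ω, (esAction κ S₀ U (fun m => ((ω : Λ → sphere (0 : E) 1) m : E)) - S₀) *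
        (‖localField U k (fun m => (ω m : E))‖ ^ 2 -
          ⟪localField U k (fun m => (ω m : E)), ((ω k : sphere (0 : E) 1) : E)⟫ ^ 2)
          ∂Measure.pi (fun _ : Λ => uniformSphere (volume : Measure E)) =
      (1 - 1 / (Module.finrank ℝ E : ℝ)) * (-(2 * κ) / (Module.finrank ℝ E : ℝ) ^ 2 *
        ∑ n, ∑ m, ∑ i, ⟪U k n (U n m (stdOrthonormalBasis ℝ E i)),
          U k m (stdOrthonormalBasis ℝ E i)⟫) := by
    intro k
    have hIa : Integrable (fun ω : Λ → sphere (0 : E) 1 =>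
        (esAction κ S₀ U (fun m => (ω m : E)) - S₀) * ‖localField U k (fun m => (ω m : E))‖ ^ 2)
        (Measure.pi fun _ : Λ => uniformSphere (volume : Measure E)) := integrable_pi_of_continuous (uniformSphere (volume : Measure E)) (hS.mul ((hJs k).norm.pow 2))
    have hIb : Integrable (fun ω : Λ → sphere (0 : E) 1 =>
        (esAction κ S₀ U (fun m => (ω m : E)) - S₀) *
          ⟪localField U k (fun m => (ω m : E)), ((ω k : sphere (0 : E) 1) : E)⟫ ^ 2)
        (Measure.pi fun _ : Λ => uniformSphere (volume : Measure E)) :=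
      integrable_pi_of_continuous (uniformSphere (volume : Measure E))
        (hS.mul (((hJs k).inner (continuous_subtype_val.comp (continuous_apply k))).pow 2))
    simp_rw [mul_sub]
    rw [integral_sub hIa hIb, integral_esAction_sub_mul_sq_inner_localField h2 hU0 hUadj κ S₀ k,
      integral_esAction_sub_mul_norm_sq_localField h2 hU0 κ S₀ k]
    ring
  simp_rw [hk] at h
  have key : 4 * κ ^ 2 * ∑ k, (1 - 1 / (Module.finrank ℝ E : ℝ)) *
        (-(2 * κ) / (Module.finrank ℝ E : ℝ) ^ 2 *
          ∑ n, ∑ m, ∑ i, ⟪U k n (U n m (stdOrthonormalBasis ℝ E i)),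
            U k m (stdOrthonormalBasis ℝ E i)⟫) =
      ((Module.finrank ℝ E : ℝ) - 1) * (-(8 * κ ^ 3) / (Module.finrank ℝ E : ℝ) ^ 3 *
        ∑ k, ∑ n, ∑ m, ∑ i, ⟪U k n (U n m (stdOrthonormalBasis ℝ E i)),
          U k m (stdOrthonormalBasis ℝ E i)⟫) := by
    rw [Finset.mul_sum, Finset.mul_sum, Finset.mul_sum]
    refine Finset.sum_congr rfl fun k _ => ?_
    field_simp
    ring
  rw [key] at h
  exact mul_left_cancel₀ hd1 h

/-- The same with the opposite sign convention: **`∫ (S₀ − S)³ dπ̄ = (8κ³/d³)·Σ_{k,n,m} τ(k,n,m)`**. -/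
theorem integral_pow_three_const_sub_esAction (h2 : 2 ≤ Module.finrank ℝ E) (hU0 : ∀ n, U n n = 0)
    (hUadj : ∀ m n (v w : E), ⟪U m n v, w⟫ = ⟪v, U n m w⟫) (κ S₀ : ℝ) :
    ∫ ω, (S₀ - esAction κ S₀ U (fun m => ((ω : Λ → sphere (0 : E) 1) m : E))) ^ 3
        ∂Measure.pi (fun _ : Λ => uniformSphere (volume : Measure E)) =
      8 * κ ^ 3 / (Module.finrank ℝ E : ℝ) ^ 3 *
        ∑ k, ∑ n, ∑ m, ∑ i, ⟪U k n (U n m (stdOrthonormalBasis ℝ E i)),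
          U k m (stdOrthonormalBasis ℝ E i)⟫ := by
  have hpt : ∀ ω : Λ → sphere (0 : E) 1,
      (S₀ - esAction κ S₀ U (fun m => (ω m : E))) ^ 3 =
        -((esAction κ S₀ U (fun m => (ω m : E)) - S₀) ^ 3) := fun ω => by ring
  simp_rw [hpt]
  rw [integral_neg, third_moment_esAction_eq h2 hU0 hUadj κ S₀]
  ring

omit [MeasurableSpace E] [BorelSpace E] [DecidableEq Λ] [Nontrivial E] in
/-- On a TRIANGLE-FREE coupling graph (`U_kn ≠ 0 ∧ U_nm ≠ 0 ⇒ U_km = 0`) every triangle trace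
vanishes, so the sum `Σ_{k,n,m} τ(k,n,m)` is zero. -/
theorem sum_triangle_trace_eq_zero_of_triangle_free
    (htri : ∀ k n m, U k n ≠ 0 → U n m ≠ 0 → U k m = 0) :
    ∑ k, ∑ n, ∑ m, ∑ i, ⟪U k n (U n m (stdOrthonormalBasis ℝ E i)),
        U k m (stdOrthonormalBasis ℝ E i)⟫ = 0 := by
  refine Finset.sum_eq_zero fun k _ => Finset.sum_eq_zero fun n _ =>
    Finset.sum_eq_zero fun m _ => Finset.sum_eq_zero fun i _ => ?_
  by_cases hkn : U k n = 0
  · simp [hkn]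
  by_cases hnm : U n m = 0
  · simp [hnm]
  simp [htri k n m hkn hnm]

/-- **On a triangle-free coupling graph the action has vanishing third central moment**
(`∫(S − S₀)³ dπ̄ = 0`). -/
theorem third_moment_esAction_eq_zero_of_triangle_free (h2 : 2 ≤ Module.finrank ℝ E)
    (hU0 : ∀ n, U n n = 0) (hUadj : ∀ m n (v w : E), ⟪U m n v, w⟫ = ⟪v, U n m w⟫)
    (htri : ∀ k n m, U k n ≠ 0 → U n m ≠ 0 → U k m = 0) (κ S₀ : ℝ) :
    ∫ ω, (esAction κ S₀ U (fun m => ((ω : Λ → sphere (0 : E) 1) m : E)) - S₀) ^ 3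
        ∂Measure.pi (fun _ : Λ => uniformSphere (volume : Measure E)) = 0 := by
  rw [third_moment_esAction_eq h2 hU0 hUadj κ S₀, sum_triangle_trace_eq_zero_of_triangle_free htri,
    mul_zero]

end ThirdMoment

/-! ## §4 Lüscher's NNLO constant `ċ₂` -/

section Luscher

variable {St : ℕ → (Λ → E) → ℝ} {c : ℕ → ℝ}

/-- **LÜSCHER'S NNLO CONSTANT IN CLOSED FORM: `ċ₂ = (4κ³/d³)·Σ_k Σ_n Σ_m Σ_i ⟪U_kn U_nm b_i, U_km b_i⟫`**
for EVERY `C²` Lüscher series of the lattice CP(N−1)/O(N) action (`ċ₂ = κ₃(−S)/2` by the moment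
identity, and the third cumulant is the triangle sum). -/
theorem luscher_constant_two_eq_triangles (h2 : 2 ≤ Module.finrank ℝ E) (hU0 : ∀ n, U n n = 0)
    (hUadj : ∀ m n (v w : E), ⟪U m n v, w⟫ = ⟪v, U n m w⟫) (κ S₀ : ℝ)
    (hSt : ∀ k, ContDiff ℝ 2 (St k))
    (h0 : ∀ ξ : Λ → sphere (0 : E) 1,
      -∑ n, siteLaplacian n (St 0) (fun m => (ξ m : E)) = esAction κ S₀ U (fun m => (ξ m : E)) + c 0)
    (hs : ∀ k, ∀ ξ : Λ → sphere (0 : E) 1,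
      -∑ n, siteLaplacian n (St (k + 1)) (fun m => (ξ m : E)) =
        -(∑ n, ⟪siteGrad n (esAction κ S₀ U) (fun m => (ξ m : E)),
            siteGrad n (St k) (fun m => (ξ m : E))⟫) + c (k + 1)) :
    c 2 = 4 * κ ^ 3 / (Module.finrank ℝ E : ℝ) ^ 3 *
      ∑ k, ∑ n, ∑ m, ∑ i, ⟪U k n (U n m (stdOrthonormalBasis ℝ E i)),
        U k m (stdOrthonormalBasis ℝ E i)⟫ := by
  have hSa : ContDiff ℝ 1 (fun x : Λ → E => esAction κ S₀ U x - S₀) :=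
    (contDiff_esAction U κ S₀).sub contDiff_const
  have h := luscher_constant_two_eq hSa hSt (luscher_series_shift_zero S₀ h0)
    (luscher_series_shift_succ S₀ hs)
  rw [update_of_ne (by norm_num : (2 : ℕ) ≠ 0)] at h
  have hSc : Continuous fun ω : Λ → sphere (0 : E) 1 => esAction κ S₀ U (fun m => (ω m : E)) :=
    (contDiff_esAction U κ S₀ (m := 0)).continuous.comp continuous_sphereConfig
  have hm1 : ∫ ω, -(fun x : Λ → E => esAction κ S₀ U x - S₀)
      (fun m => ((ω : Λ → sphere (0 : E) 1) m : E)) ∂Measure.pi (fun _ : Λ => uniformSphere (volume : Measure E)) = 0 := by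
    show ∫ ω, -(esAction κ S₀ U (fun m => ((ω : Λ → sphere (0 : E) 1) m : E)) - S₀)
      ∂Measure.pi (fun _ : Λ => uniformSphere (volume : Measure E)) = 0
    rw [integral_neg, integral_sub (integrable_pi_of_continuous (uniformSphere (volume : Measure E)) hSc) (integrable_const _),
      integral_esAction_uniform hU0 hUadj h2 κ S₀, integral_const, smul_eq_mul, Measure.real,
      measure_univ, ENNReal.toReal_one, one_mul, sub_self, neg_zero]
  have hm3 : ∫ ω, (-(fun x : Λ → E => esAction κ S₀ U x - S₀)
      (fun m => ((ω : Λ → sphere (0 : E) 1) m : E))) ^ 3 ∂Measure.pi (fun _ : Λ => uniformSphere (volume : Measure E)) =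
      ∫ ω, (S₀ - esAction κ S₀ U (fun m => ((ω : Λ → sphere (0 : E) 1) m : E))) ^ 3
        ∂Measure.pi (fun _ : Λ => uniformSphere (volume : Measure E)) := by
    refine integral_congr_ae (ae_of_all _ fun ω => ?_)
    dsimp only
    ring
  rw [hm1, hm3, integral_pow_three_const_sub_esAction h2 hU0 hUadj κ S₀] at h
  rw [h]
  ring

/-- **`ċ₂ = 0` ON EVERY TRIANGLE-FREE COUPLING GRAPH** (bipartite graphs — parity, GEN-12 T4 — are
the case with no odd cycles at all; here only 3-cycles matter). -/
theorem luscher_constant_two_eq_zero_of_triangle_free (h2 : 2 ≤ Module.finrank ℝ E)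
    (hU0 : ∀ n, U n n = 0) (hUadj : ∀ m n (v w : E), ⟪U m n v, w⟫ = ⟪v, U n m w⟫)
    (htri : ∀ k n m, U k n ≠ 0 → U n m ≠ 0 → U k m = 0) (κ S₀ : ℝ)
    (hSt : ∀ k, ContDiff ℝ 2 (St k))
    (h0 : ∀ ξ : Λ → sphere (0 : E) 1,
      -∑ n, siteLaplacian n (St 0) (fun m => (ξ m : E)) = esAction κ S₀ U (fun m => (ξ m : E)) + c 0)
    (hs : ∀ k, ∀ ξ : Λ → sphere (0 : E) 1,
      -∑ n, siteLaplacian n (St (k + 1)) (fun m => (ξ m : E)) =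
        -(∑ n, ⟪siteGrad n (esAction κ S₀ U) (fun m => (ξ m : E)),
            siteGrad n (St k) (fun m => (ξ m : E))⟫) + c (k + 1)) :
    c 2 = 0 := by
  rw [luscher_constant_two_eq_triangles h2 hU0 hUadj κ S₀ hSt h0 hs,
    sum_triangle_trace_eq_zero_of_triangle_free htri, mul_zero]

end Luscher

end Summit.Ventures.LatticeQCDFlow.Exactness

end
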